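import Summits.HodgeConjecture.HodgeConjecture.Theorems.F0P3cDyRamEigenFieldCompletionModel  -- ★ `exists_completionModel` (`L_w = L⁺_v ⊕ L⁺_v·δ`, conjugation `σ_w`)
import Literature.NumberTheory.Automorphic.QuadraticLocalBaseChange                           -- ★ `toPlace`, `continuous_toPlace`, `toPlace_coe`
import Mathlib.FieldTheory.PrimitiveElement
import HarnessLib

/-!
# R90-TF · S3, (U3-F) brick P8b: THE QUADRATIC DENSE LIFT — a dense `J₀ : F′ → L⁺_v` with `J₀ γ = m·s²` lifts to a dense, conjugation-equivariant
# `J̃ : L′ = F′(√γ) → L_w = L⁺_v(√m)`, `√γ ↦ s·√m`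
# (`Theorems/R90S3QuadraticDenseLift.lean`; dealer R90-C12-plan (g2) 00:49:23Z «P8b … «=» as cut — TYPE IT»; its outputs are exactly the inputs of ★ P8a `R90S3PlantedLocalIso`)

Cell `hodgecm-mathlib`, crux H413 (`stmt-HodgeConjecture-24833`), route of record `HCCMUnconditional`; programme R90-TF, section S3 (base `R90-C12`), the (U3-F)
residual `stub_R90_S3_auxGlobaliseField` (ℚ-planted road, memo `DEAL-S3-U3F-SPLIT.v2.md` §1 row P8).  Lane `--supports stmt-HodgeConjecture-24833 --as helper`;
THEOREMS ONLY; ★-only imports; ns `…R90.S3`.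

THE MATHEMATICS [Rogawski1990 §13.8 p. 216; Cassels–Fröhlich II §10].  `L` CM with `L = L⁺(δ)`, `c δ = −δ`, `δ² = m ∈ L⁺`, `m` not a square in `K := L⁺_v` (so `v` is
non-split and ★ `exists_completionModel` presents `L_w = K ⊕ K·δ` with `σ_w δ = −δ`, `σ_w` fixing `K`); `L′ ⊇ F′` quadratic, CM, with `θ² = γ ∈ F′`, `θ ∉ F′`, the
complex conjugation `c′` of `L′` fixing `F′`; `J₀ : F′ →+* K` with DENSE image and `J₀ γ = m·s²`.  Then:
* §1 `L′ = F′(θ)` has the power basis of `θ` with `minpoly θ = X² − γ` (Mathlib `Field.primitive_element_iff_minpoly_natDegree_eq`), and `c′ θ = −θ`;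
* §2 HEAD `exists_denseRange_equivariant_lift`: with `y := ι(s)·δ` (`ι = toPlace v w : K → L_w`), `y² = ι(J₀ γ)`, so `J̃ := lift (θ ↦ y)` over `ι ∘ J₀` is a ring
  homomorphism `L′ →+* L_w` with `J̃|_{F′} = ι ∘ J₀`, `J̃ θ = y`; it is EQUIVARIANT (`J̃ ∘ c′` and `σ_w ∘ J̃` are `F′`-algebra maps agreeing on `θ ↦ −y`) and has DENSE
  image (`L_w ∋ z = ι p + ι q·δ = ι p + ι(q∕s)·y`, the map `(p, q′) ↦ ι p + ι q′·y` is continuous and onto, and `J₀ × J₀` has dense image).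
HONEST LABEL: P8b is a sub-brick of the GENUINE residual (U3-F) and closes nothing alone; HC_CM is proved only modulo the 7 printed citations (2 remaining named
inputs: hLiu418 = stmt-HodgeConjecture-24832, h413 = stmt-HodgeConjecture-24833) until rung 0 closes; count-neutral helper.

## References
* [Rogawski1990] J. D. Rogawski, *Automorphic Representations of Unitary Groups in Three Variables*, Ann. of Math. Stud. 123 (1990), §13.8 p. 216.
* [CasselsFrohlichANT1967] J. W. S. Cassels, A. Fröhlich (eds.), *Algebraic Number Theory* (1967), Ch. II §10.
-/

set_option autoImplicit false
-- the mandated namespace repeats the single-problem summit's segment (`HodgeConjecture.HodgeConjecture`)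
set_option linter.dupNamespace false

noncomputable section

open IsDedekindDomain NumberField Topology Polynomial IntermediateField
open Literature.NumberTheory.Automorphic Literature.NumberTheory.Automorphic.UnitaryGroup
open Summit.HodgeConjecture.HodgeConjecture.Cruxes.H413.F0P3cDyRamEigenFieldCompletionModel (exists_completionModel)

namespace Summit.HodgeConjecture.HodgeConjecture.R90.S3

/-! ## §1 The quadratic field `L′ = F′(θ)`: power basis and the action of `c′` on `θ` -/

section Quadratic

variable {F' L' : Type} [Field F'] [Field L'] [Algebra F' L'] [Algebra.IsQuadraticExtension F' L']
  {θ : L'} {γ : F'} (hθ : θ ^ 2 = algebraMap F' L' γ) (hθF : θ ∉ Set.range (algebraMap F' L'))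

include hθ hθF in
/-- `minpoly_{F′} θ = X² − γ` for `θ² = γ`, `θ ∉ F′`. [folklore] -/
theorem minpoly_eq_X_sq_sub_C : minpoly F' θ = X ^ 2 - C γ := by
  haveI : Module.Finite F' L' := Module.finite_of_finrank_eq_succ (Algebra.IsQuadraticExtension.finrank_eq_two F' L')
  have hint : IsIntegral F' θ := Algebra.IsIntegral.isIntegral θ
  have hmon : (X ^ 2 - C γ : F'[X]).Monic := monic_X_pow_sub_C γ two_ne_zero
  have hdvd : minpoly F' θ ∣ X ^ 2 - C γ := minpoly.dvd F' θ (by simp [hθ])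
  have h2 : 2 ≤ (minpoly F' θ).natDegree := (minpoly.two_le_natDegree_iff hint).2 (by rwa [RingHom.mem_range, ← Set.mem_range])
  exact (eq_of_monic_of_dvd_of_natDegree_le (minpoly.monic hint) hmon hdvd (by rw [natDegree_X_pow_sub_C]; exact h2)).symm

include hθ hθF in
/-- `F′⟮θ⟯ = L′` (degree count). [folklore] -/
theorem adjoin_simple_eq_top_of_sq_eq : F'⟮θ⟯ = ⊤ := by
  rw [Field.primitive_element_iff_minpoly_natDegree_eq, minpoly_eq_X_sq_sub_C hθ hθF, natDegree_X_pow_sub_C, Algebra.IsQuadraticExtension.finrank_eq_two F' L']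

include hθ hθF in
/-- **A power basis of `L′ ∕ F′` with generator `θ`.** [folklore] -/
theorem exists_powerBasis_gen_eq : ∃ pb : PowerBasis F' L', pb.gen = θ := by
  haveI : Module.Finite F' L' := Module.finite_of_finrank_eq_succ (Algebra.IsQuadraticExtension.finrank_eq_two F' L')
  have hint : IsIntegral F' θ := Algebra.IsIntegral.isIntegral θ
  refine ⟨(adjoin.powerBasis hint).map ((equivOfEq (adjoin_simple_eq_top_of_sq_eq hθ hθF)).trans topEquiv), ?_⟩
  rw [PowerBasis.map_gen, adjoin.powerBasis_gen]
  rfl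

include hθ hθF in
/-- **`c′ θ = −θ`** for any automorphism `c′ ≠ 1` of `L′` fixing `F′` pointwise (it is an `F′`-algebra map, so `c′ θ = θ` would force `c′ = 1`; and `(c′ θ)² = γ`). [folklore] -/
theorem apply_eq_neg_of_sq_eq {E : Type*} [Field E] [Algebra E L'] (c' : L' ≃ₐ[E] L') (hc1 : c' ≠ 1)
    (hcF : ∀ a : F', c' (algebraMap F' L' a) = algebraMap F' L' a) : c' θ = -θ := by
  obtain ⟨pb, hpb⟩ := exists_powerBasis_gen_eq hθ hθF
  -- `c′` as an `F′`-algebra map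
  let c'' : L' →ₐ[F'] L' := { c'.toRingEquiv.toRingHom with commutes' := hcF }
  have hsq : (c' θ) ^ 2 = θ ^ 2 := by rw [← map_pow, hθ]; exact hcF γ
  rcases sq_eq_sq_iff_eq_or_eq_neg.1 hsq with h | h
  · exfalso
    apply hc1
    have hid : c'' = AlgHom.id F' L' := pb.algHom_ext (by rw [hpb]; exact h)
    exact AlgEquiv.ext fun x => (congrArg (fun f : L' →ₐ[F'] L' => f x) hid : _)
  · exact h

end Quadratic

/-! ## §2 HEAD: the dense, equivariant lift `J̃ : L′ → L_w` -/

/-- **P8b — THE QUADRATIC DENSE LIFT.**  `L` CM with `δ ∈ L`, `c δ = −δ`, `δ ≠ 0`, `δ² = m ∈ L⁺`, `m` not a square in `L⁺_v`; `L′ ⊇ F′` quadratic and CM with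
`θ² = γ`, `θ ∉ F′`, the complex conjugation of `L′` fixing `F′`; `J₀ : F′ →+* L⁺_v` with dense image and `J₀ γ = m·s²`.  Then there are the (unique, conjugation-fixed)
place `w ∣ v` of `L` and a ring homomorphism `J̃ : L′ →+* L_w` extending `ι_w ∘ J₀` (`ι_w = toPlace v w`) with `J̃ θ = ι_w(s)·δ`, DENSE image, and
`J̃ ∘ c′ = σ_w ∘ J̃` (`σ_w = galAdicCompletionMap c hw`) — the three inputs of ★ P8a `exists_localRing_equiv_of_denseRange_equivariant`.
[cite: Rogawski1990, §13.8 p. 216] [cite: CasselsFrohlichANT1967, Ch. II §10] -/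
theorem exists_denseRange_equivariant_lift
    (L : Type) [Field L] [NumberField L] [IsCMField L] (v : HeightOneSpectrum (𝓞 ↥(maximalRealSubfield L)))
    {δ : L} (hcδ : IsCMField.complexConj L δ = -δ) (hδ : δ ≠ 0) {m : ↥(maximalRealSubfield L)} (hm : algebraMap ↥(maximalRealSubfield L) L m = δ ^ 2)
    (hns : ¬ IsSquare ((m : ↥(maximalRealSubfield L)) : v.adicCompletion ↥(maximalRealSubfield L)))
    (F' L' : Type) [Field F'] [Field L'] [NumberField L'] [IsCMField L'] [Algebra F' L'] [Algebra.IsQuadraticExtension F' L']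
    {θ : L'} {γ : F'} (hθ : θ ^ 2 = algebraMap F' L' γ) (hθF : θ ∉ Set.range (algebraMap F' L'))
    (hcF : ∀ a : F', IsCMField.complexConj L' (algebraMap F' L' a) = algebraMap F' L' a)
    (J₀ : F' →+* v.adicCompletion ↥(maximalRealSubfield L)) (hJ₀ : DenseRange J₀)
    (s : v.adicCompletion ↥(maximalRealSubfield L)) (hs : J₀ γ = (m : v.adicCompletion ↥(maximalRealSubfield L)) * s ^ 2) :
    ∃ (w : PlacesOver L v) (hw : IsCMField.complexConj L • w.1 = w.1) (J : L' →+* w.1.adicCompletion L),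
      DenseRange J ∧
      (∀ x : L', J (IsCMField.complexConj L' x) = galAdicCompletionMap (L := L) (IsCMField.complexConj L) hw (J x)) ∧
      (∀ a : F', J (algebraMap F' L' a) = toPlace v w (J₀ a)) ∧
      J θ = toPlace v w s * ((δ : L) : w.1.adicCompletion L) := by
  haveI : Algebra.IsQuadraticExtension ↥(maximalRealSubfield L) L := IsCMField.isQuadraticExtension L
  -- the completion model `L_w = K ⊕ K·δ`
  obtain ⟨w, hw, -, -, hρι, -, hδ2, hρδ, huniq, -⟩ :=
    exists_completionModel L v (IsCMField.complexConj L) (IsCMField.complexConj_ne_one L) hcδ hδ hm hns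
  -- `y := ι(s)·δ` (`ι = toPlace v w`), kept opaque with its defining equation
  obtain ⟨y, hy⟩ : ∃ y : w.1.adicCompletion L, y = toPlace v w s * ((δ : L) : w.1.adicCompletion L) := ⟨_, rfl⟩
  -- `γ ≠ 0`, `s ≠ 0`
  have hγ0 : γ ≠ 0 := by
    rintro rfl
    apply hθF
    rw [map_zero, sq_eq_zero_iff] at hθ
    exact ⟨0, by rw [map_zero, hθ]⟩
  have hs0 : s ≠ 0 := by
    rintro rfl
    rw [zero_pow two_ne_zero, mul_zero] at hs
    exact (map_ne_zero J₀).2 hγ0 hs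
  -- the `F′`-algebra structure on `L_w` through `ι ∘ J₀`, and `y² = ι (J₀ γ)`
  letI alg : Algebra F' (w.1.adicCompletion L) := ((toPlace v w).comp J₀).toAlgebra
  have halg : ∀ a : F', algebraMap F' (w.1.adicCompletion L) a = toPlace v w (J₀ a) := fun a => rfl
  have hy2 : y ^ 2 = algebraMap F' (w.1.adicCompletion L) γ := by
    rw [halg, hs, map_mul, map_pow, hy, mul_pow, hδ2]
    ring
  -- the lift `θ ↦ y`
  obtain ⟨pb, hpb⟩ := exists_powerBasis_gen_eq hθ hθF
  have hmin : minpoly F' pb.gen = X ^ 2 - C γ := by rw [hpb]; exact minpoly_eq_X_sq_sub_C hθ hθF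
  have hyroot : aeval y (minpoly F' pb.gen) = 0 := by
    rw [hmin]
    simp only [map_sub, map_pow, aeval_X, aeval_C, hy2, sub_self]
  let φ : L' →ₐ[F'] w.1.adicCompletion L := pb.lift y hyroot
  have hφθ : φ θ = y := by rw [← hpb]; exact pb.lift_gen y hyroot
  have hφa : ∀ a : F', φ (algebraMap F' L' a) = toPlace v w (J₀ a) := fun a => by rw [φ.commutes, halg]
  -- `c′ θ = −θ`
  have hcθ : IsCMField.complexConj L' θ = -θ := apply_eq_neg_of_sq_eq hθ hθF (IsCMField.complexConj L') (IsCMField.complexConj_ne_one L') hcF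
  refine ⟨w, hw, φ.toRingHom, ?_, ?_, hφa, hφθ.trans hy⟩
  · -- DENSITY: `z = ι p + ι q · δ = ι p + ι (q / s) · y`
    have hΘ : Continuous fun pq : v.adicCompletion ↥(maximalRealSubfield L) × v.adicCompletion ↥(maximalRealSubfield L) =>
        toPlace v w pq.1 + toPlace v w pq.2 * y :=
      ((continuous_toPlace v w).comp continuous_fst).add (((continuous_toPlace v w).comp continuous_snd).mul continuous_const)
    have hΘsurj : DenseRange fun pq : v.adicCompletion ↥(maximalRealSubfield L) × v.adicCompletion ↥(maximalRealSubfield L) =>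
        toPlace v w pq.1 + toPlace v w pq.2 * y := by
      refine Function.Surjective.denseRange fun z => ?_
      obtain ⟨pq, hpq, -⟩ := huniq z
      refine ⟨(pq.1, pq.2 / s), ?_⟩
      dsimp only
      rw [hpq, hy, ← mul_assoc, ← map_mul, div_mul_cancel₀ pq.2 hs0]
    have hcomp := hΘsurj.comp (hJ₀.prodMap hJ₀) hΘ
    refine Dense.mono ?_ hcomp
    rintro _ ⟨⟨a, b⟩, rfl⟩
    refine ⟨algebraMap F' L' a + algebraMap F' L' b * θ, ?_⟩
    simp only [Function.comp_apply, Prod.map_apply, AlgHom.toRingHom_eq_coe, RingHom.coe_coe, map_add, map_mul, hφa, hφθ]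
  · -- EQUIVARIANCE: two `F′`-algebra maps agreeing on `θ`
    set ρ := galAdicCompletionMap (L := L) (IsCMField.complexConj L) hw with hρ
    let f₁ : L' →ₐ[F'] w.1.adicCompletion L :=
      { (φ.toRingHom.comp (IsCMField.complexConj L').toRingEquiv.toRingHom) with
        commutes' := fun a => by
          change φ (IsCMField.complexConj L' (algebraMap F' L' a)) = _
          rw [hcF, hφa, halg] }
    let f₂ : L' →ₐ[F'] w.1.adicCompletion L :=
      { (ρ.comp φ.toRingHom) with
        commutes' := fun a => by
          change ρ (φ (algebraMap F' L' a)) = _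
          rw [hφa, halg]
          exact hρι (J₀ a) }
    have hf : f₁ = f₂ := pb.algHom_ext (by
      change φ (IsCMField.complexConj L' pb.gen) = ρ (φ pb.gen)
      rw [hpb, hcθ, map_neg, hφθ, hy, map_mul, hρδ, hρι, mul_neg])
    intro x
    exact (congrArg (fun f : L' →ₐ[F'] w.1.adicCompletion L => f x) hf : _)

end Summit.HodgeConjecture.HodgeConjecture.R90.S3

end
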